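import Summits.FinalStateConjecture.FinalStateConjecture.Theorems.EIHFluxBalanceInertialRecessionStubEndgameBallistic
import Summits.FinalStateConjecture.FinalStateConjecture.Theorems.EIHFluxBalanceInertialRecessionStubEndgameVelocityLimits

/-!
# Route EIHFluxBalance — crux `InertialRecession`, line `sublinear-is-free-clean-window-charges`:
# the N-body CLEAN-SCALE TOY (disprover's `ToyCleanScaleFrozenMotion`, `p = 3/2`) — basic bricks

Helper file for the crux `stmt-FinalStateConjecture-10166`
(`Summit.FinalStateConjecture.FinalStateConjecture.Theses.EIHFluxBalance.InertialRecession`), registered stub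
`stub_pairwiseDichotomy` (lead reshape r7) of `Cruxes/InertialRecession/Lines/sublinear_is_free_clean_window_charges.lean`.

THE TOY (disprover `cdisprove`, `Cruxes/InertialRecession/Disproof.lean`, §I, `ToyCleanScaleFrozenMotion N n p`, open there for
`N ≥ 3`): `N` world-lines `ξᵢ` in `ℝⁿ` (sup norm) with velocities `vᵢ = ξ̇ᵢ` and accelerations `aᵢ = v̇ᵢ`, pairwise separating, and
CLEAN-CLUSTER BALANCE: for every nonempty cluster `C` isolated by distance `r ≤ t` at time `t ≥ t₀`, `‖Σ_{i∈C} mᵢ aᵢ(t)‖ ≤ K r^{-p}`.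
Claim: every `vᵢ(t)` converges. This series (`…ToyBasics`, `…ToyInduction`, `…ToyFrozen`) proves it for `p = 3/2` and every
`N`, by the velocity-space clustering argument of the lead's general-`N` roadmap (`Endgame_generalN_roadmap.md`, evidence on the
item): a pigeonhole EMPTY BAND makes "slow" transitive and separates the wobble of slow classes from the ballistic tolerance of
fast pairs; Lemma Λ(n) by induction on class size with nested first-exit bootstraps. The toy has exact momenta and pointwise
balance, so no window admissibility / piece machinery / `ζ` errors appear — it is the core of the abstract endgame with the GR
plumbing stripped.

THIS FILE (bricks): `norm_sub_weightedMean_le'` (wobble ≤ spread, any normed space); `exists_abs_apply_eq_norm` (a sup-norm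
coordinate realising the norm); `bootstrap_principle` (continuous induction for a finite family of continuous functions);
`hasDerivAt_clusterMomentum`, `norm_sum_smul_accel_le` (balance ⇒ `‖Π̇_C‖ ≤ K(φ + (s√s)⁻¹)` for any majorant `φ` of the inverse
`3/2`-powers of the cross distances), `norm_clusterMomentum_sub_le` (increment by a boundary-function mean-value argument — the
accelerations are derivatives, not assumed integrable); `exists_sign_coord`, `speed_of_deviation`, `ballistic_majorant` (a pair
whose relative velocity stays within `W/2` of its initial value `W` keeps a coordinate of speed `≥ W/2`, and the inverse powers
of its distance are majorised by `2√2((|x|+A)√(|x|+A))⁻¹`, whose integral is `≤ 2√2·8/(W√A)` by `integral_ballistic_le`).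

References: D. Saari, Trans. AMS 156 (1971) 219–240; C. Marchal, D. Saari, J. Differential Equations 20 (1976) 150–186.
-/

noncomputable section

set_option linter.dupNamespace false

open Filter Topology Set MeasureTheory intervalIntegral
open scoped Topology BigOperators

namespace Summit.FinalStateConjecture.FinalStateConjecture.Theorems.SublinearIsFree.Toy

open Literature.Geometry.Lorentzian
open Summit.FinalStateConjecture.FinalStateConjecture.Theorems.SublinearIsFree.Endgame

/-! ### Generic bricks -/

/-- WOBBLE ≤ SPREAD (any normed space): for positive weights `μ j` on a finite set `A ∋ k`, the weighted mean
`V = (Σ_A μ j • u j)/(Σ_A μ j)` satisfies `‖u k − V‖ ≤ η` as soon as `‖u k − u l‖ ≤ η` for all `l ∈ A`. [folklore] -/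
theorem norm_sub_weightedMean_le' {ι E : Type*} [NormedAddCommGroup E] [NormedSpace ℝ E]
    (A : Finset ι) (μ : ι → ℝ) (u : ι → E) {k : ι} {η : ℝ}
    (hk : k ∈ A) (hμ : ∀ j ∈ A, 0 < μ j) (hη : ∀ l ∈ A, ‖u k - u l‖ ≤ η) :
    ‖u k - (∑ j ∈ A, μ j)⁻¹ • ∑ j ∈ A, μ j • u j‖ ≤ η := by
  have hW : 0 < ∑ j ∈ A, μ j := Finset.sum_pos hμ ⟨k, hk⟩
  have hrepr : u k - (∑ j ∈ A, μ j)⁻¹ • ∑ j ∈ A, μ j • u j =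
      (∑ j ∈ A, μ j)⁻¹ • ∑ j ∈ A, μ j • (u k - u j) := by
    have h1 : ∑ j ∈ A, μ j • (u k - u j) = (∑ j ∈ A, μ j) • u k - ∑ j ∈ A, μ j • u j := by
      simp only [smul_sub, Finset.sum_sub_distrib, Finset.sum_smul]
    rw [h1, smul_sub, smul_smul, inv_mul_cancel₀ hW.ne', one_smul]
  rw [hrepr, norm_smul, norm_inv, Real.norm_eq_abs, abs_of_pos hW]
  calc (∑ j ∈ A, μ j)⁻¹ * ‖∑ j ∈ A, μ j • (u k - u j)‖
      ≤ (∑ j ∈ A, μ j)⁻¹ * ∑ j ∈ A, μ j * η := by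
        refine mul_le_mul_of_nonneg_left ((norm_sum_le _ _).trans (Finset.sum_le_sum fun j hj ↦ ?_))
          (inv_nonneg.mpr hW.le)
        rw [norm_smul, Real.norm_eq_abs, abs_of_pos (hμ j hj)]
        exact mul_le_mul_of_nonneg_left (hη j hj) (hμ j hj).le
    _ = η := by
        rw [← Finset.sum_mul, ← mul_assoc, inv_mul_cancel₀ hW.ne', one_mul]

/-- In the sup norm on `Fin n → ℝ`, a nonzero vector has a coordinate realising its norm. [folklore] -/
theorem exists_abs_apply_eq_norm {n : ℕ} (x : Fin n → ℝ) (hx : 0 < ‖x‖) : ∃ ℓ : Fin n, |x ℓ| = ‖x‖ := by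
  have hne : (Finset.univ : Finset (Fin n)).Nonempty := by
    by_contra h
    rw [Finset.not_nonempty_iff_eq_empty, Finset.univ_eq_empty_iff] at h
    have : x = 0 := Subsingleton.elim _ _
    rw [this, norm_zero] at hx
    exact lt_irrefl _ hx
  obtain ⟨ℓ, -, hℓ⟩ := Finset.exists_max_image Finset.univ (fun i ↦ |x i|) hne
  refine ⟨ℓ, le_antisymm ?_ ?_⟩
  · simpa [Real.norm_eq_abs] using norm_le_pi_norm x ℓ
  · exact (pi_norm_le_iff_of_nonneg (abs_nonneg _)).mpr fun i ↦ by
      simpa [Real.norm_eq_abs] using hℓ i (Finset.mem_univ i)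

/-- **BOOTSTRAP PRINCIPLE (continuous induction) for a finite family.** Let `f i`, `i ∈ I` finite, be continuous, with
`f i a ≤ c′ i < c i`. If on every initial segment `[a, u′] ⊆ [a, u]` the weak bounds `f i ≤ c i` imply the strong bounds
`f i ≤ c′ i`, then the strong bounds hold on all of `[a, u]` (first-exit argument). [folklore] -/
theorem bootstrap_principle {ι : Type*} (I : Finset ι) (f : ι → ℝ → ℝ) (c c' : ι → ℝ) {a u : ℝ} (hau : a ≤ u)
    (hcont : ∀ i ∈ I, Continuous (f i)) (hcc : ∀ i ∈ I, c' i < c i) (hinit : ∀ i ∈ I, f i a ≤ c' i)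
    (hstep : ∀ u' ∈ Icc a u, (∀ i ∈ I, ∀ t ∈ Icc a u', f i t ≤ c i) → ∀ i ∈ I, ∀ t ∈ Icc a u', f i t ≤ c' i) :
    ∀ i ∈ I, ∀ t ∈ Icc a u, f i t ≤ c' i := by
  classical
  -- the bad set
  set B : Set ℝ := {t | t ∈ Icc a u ∧ ∃ i ∈ I, c i < f i t} with hB
  by_cases hBne : B.Nonempty
  swap
  · -- no bad time: the weak bounds hold everywhere
    refine hstep u (right_mem_Icc.mpr hau) fun i hi t ht ↦ ?_
    by_contra h
    exact hBne ⟨t, ht, i, hi, not_le.mp h⟩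
  exfalso
  have hBbdd : BddBelow B := ⟨a, fun t ht ↦ ht.1.1⟩
  set u₁ : ℝ := sInf B with hu₁
  have hau₁ : a ≤ u₁ := le_csInf hBne fun t ht ↦ ht.1.1
  have hu₁u : u₁ ≤ u := by
    obtain ⟨t, ht⟩ := hBne
    exact (csInf_le hBbdd ht).trans ht.1.2
  -- before `u₁` nothing is bad
  have hgood : ∀ t ∈ Ico a u₁, ∀ i ∈ I, f i t ≤ c i := by
    intro t ht i hi
    by_contra h
    have : u₁ ≤ t := csInf_le hBbdd ⟨⟨ht.1, ht.2.le.trans hu₁u⟩, i, hi, not_le.mp h⟩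
    exact absurd this (not_le.mpr ht.2)
  -- at `u₁` the weak bounds hold by continuity
  have hat : ∀ i ∈ I, f i u₁ ≤ c i := by
    intro i hi
    rcases eq_or_lt_of_le hau₁ with h | h
    · rw [← h]; exact (hinit i hi).trans (hcc i hi).le
    · have htend : Tendsto (f i) (𝓝[<] u₁) (𝓝 (f i u₁)) :=
        (hcont i hi).continuousAt.tendsto.mono_left nhdsWithin_le_nhds
      refine le_of_tendsto htend ?_
      exact mem_of_superset (Ico_mem_nhdsLT h) fun t ht ↦ hgood t ht i hi
  have hweak : ∀ i ∈ I, ∀ t ∈ Icc a u₁, f i t ≤ c i := by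
    intro i hi t ht
    rcases eq_or_lt_of_le ht.2 with h | h
    · rw [h]; exact hat i hi
    · exact hgood t ⟨ht.1, h⟩ i hi
  -- hence the strong bounds on `[a, u₁]`, in particular at `u₁`
  have hstrong := hstep u₁ ⟨hau₁, hu₁u⟩ hweak
  -- by continuity the weak bounds persist a little beyond `u₁`
  have hnear : ∀ᶠ t in 𝓝 u₁, ∀ i ∈ I, f i t < c i := by
    rw [Filter.eventually_all_finset]
    intro i hi
    exact (hcont i hi).continuousAt.eventually_lt continuousAt_const
      ((hstrong i hi u₁ (right_mem_Icc.mpr hau₁)).trans_lt (hcc i hi))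
  obtain ⟨δ, hδ, hball⟩ := Metric.eventually_nhds_iff.mp hnear
  -- so every bad time is `≥ u₁ + δ`, contradicting `u₁ = inf B`
  have hcontra : u₁ + δ ≤ u₁ := by
    rw [hu₁]
    refine le_csInf hBne fun b hb ↦ ?_
    by_contra hlt
    push Not at hlt
    have hb1 : sInf B ≤ b := csInf_le hBbdd hb
    have hdist : dist b (sInf B) < δ := by
      rw [Real.dist_eq, abs_of_nonneg (by linarith)]; linarith
    obtain ⟨i, hi, hci⟩ := hb.2
    exact absurd (hball hdist i hi) (not_lt.mpr hci.le)
  linarith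

/-! ### The toy: cluster momentum, balance, increments -/

section Toy

variable {N n : ℕ} {m : Fin N → ℝ} {ξ v a : Fin N → ℝ → (Fin n → ℝ)} {t₀ K : ℝ}

/-- The cluster momentum `Π_C = Σ_{i∈C} mᵢ vᵢ` has derivative `Σ_{i∈C} mᵢ aᵢ`. [folklore] -/
theorem hasDerivAt_clusterMomentum (hv : ∀ i t, HasDerivAt (v i) (a i t) t) (C : Finset (Fin N)) (t : ℝ) :
    HasDerivAt (fun s ↦ ∑ i ∈ C, m i • v i s) (∑ i ∈ C, m i • a i t) t :=
  HasDerivAt.fun_sum fun i _ ↦ (hv i t).const_smul (m i)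

/-- For `0 < r = min d s`: `(r√r)⁻¹ ≤ (d√d)⁻¹ + (s√s)⁻¹`. [folklore] -/
theorem inv_mul_sqrt_min_le {d s : ℝ} (hd : 0 < d) (hs : 0 < s) :
    (min d s * √(min d s))⁻¹ ≤ (d * √d)⁻¹ + (s * √s)⁻¹ := by
  rcases min_choice d s with h | h <;> rw [h]
  · have : 0 ≤ (s * √s)⁻¹ := by positivity
    linarith
  · have : 0 ≤ (d * √d)⁻¹ := by positivity
    linarith

/-- **BALANCE ⇒ ACCELERATION BOUND WITH A MAJORANT.** Under the clean-cluster balance law (exponent `3/2`), for a nonempty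
cluster `C` at a time `s ≥ t₀`, `s > 0`, with positive cross distances whose inverse `3/2`-powers are majorised by `φ ≥ 0`:
`‖Σ_{i∈C} mᵢ aᵢ(s)‖ ≤ K(φ + (s√s)⁻¹)` (isolation radius `r = min(nearest outsider, s)`). [folklore] -/
theorem norm_sum_smul_accel_le
    (hbal : ∀ (C : Finset (Fin N)) (t r : ℝ), t₀ ≤ t → 0 < r → r ≤ t → C.Nonempty →
      (∀ i ∈ C, ∀ j ∉ C, r ≤ ‖ξ i t - ξ j t‖) → ‖∑ i ∈ C, m i • a i t‖ ≤ K * r ^ (-(3 / 2 : ℝ)))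
    (hK : 0 ≤ K) {C : Finset (Fin N)} (hC : C.Nonempty) {s : ℝ} (hs : t₀ ≤ s) (hs0 : 0 < s) {φ : ℝ} (hφ0 : 0 ≤ φ)
    (hpos : ∀ i ∈ C, ∀ j ∉ C, 0 < ‖ξ i s - ξ j s‖)
    (hφ : ∀ i ∈ C, ∀ j ∉ C, (‖ξ i s - ξ j s‖ * √‖ξ i s - ξ j s‖)⁻¹ ≤ φ) :
    ‖∑ i ∈ C, m i • a i s‖ ≤ K * (φ + (s * √s)⁻¹) := by
  classical
  have hs32 : 0 ≤ (s * √s)⁻¹ := by positivity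
  by_cases hout : ∃ j, j ∉ C
  · -- the nearest outsider pair
    set P : Finset (Fin N × Fin N) := C ×ˢ (Finset.univ.filter fun j ↦ j ∉ C) with hP
    have hPne : P.Nonempty := by
      obtain ⟨i, hi⟩ := hC
      obtain ⟨j, hj⟩ := hout
      exact ⟨(i, j), Finset.mem_product.mpr ⟨hi, Finset.mem_filter.mpr ⟨Finset.mem_univ _, hj⟩⟩⟩
    obtain ⟨q, hq, hmin⟩ := Finset.exists_min_image P (fun q ↦ ‖ξ q.1 s - ξ q.2 s‖) hPne
    have hq1 : q.1 ∈ C := (Finset.mem_product.mp hq).1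
    have hq2 : q.2 ∉ C := (Finset.mem_filter.mp (Finset.mem_product.mp hq).2).2
    set d : ℝ := ‖ξ q.1 s - ξ q.2 s‖ with hd
    have hdpos : 0 < d := hpos q.1 hq1 q.2 hq2
    set r : ℝ := min d s with hr
    have hrpos : 0 < r := lt_min hdpos hs0
    have hrs : r ≤ s := min_le_right _ _
    have hiso : ∀ i ∈ C, ∀ j ∉ C, r ≤ ‖ξ i s - ξ j s‖ := fun i hi j hj ↦
      (min_le_left _ _).trans (hmin (i, j) (Finset.mem_product.mpr ⟨hi, Finset.mem_filter.mpr ⟨Finset.mem_univ _, hj⟩⟩))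
    have hb := hbal C s r hs hrpos hrs hC hiso
    rw [Real.rpow_neg hrpos.le, rpow_three_halves_eq hrpos.le] at hb
    have hdφ : (d * √d)⁻¹ ≤ φ := hφ q.1 hq1 q.2 hq2
    calc ‖∑ i ∈ C, m i • a i s‖ ≤ K * (r * √r)⁻¹ := hb
      _ ≤ K * ((d * √d)⁻¹ + (s * √s)⁻¹) := mul_le_mul_of_nonneg_left (inv_mul_sqrt_min_le hdpos hs0) hK
      _ ≤ K * (φ + (s * √s)⁻¹) := mul_le_mul_of_nonneg_left (by linarith) hK
  · -- no outsider: isolation is vacuous, take `r = s`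
    push Not at hout
    have hb := hbal C s s hs hs0 le_rfl hC fun i _ j hj ↦ absurd (hout j) hj
    rw [Real.rpow_neg hs0.le, rpow_three_halves_eq hs0.le] at hb
    calc ‖∑ i ∈ C, m i • a i s‖ ≤ K * (s * √s)⁻¹ := hb
      _ ≤ K * (φ + (s * √s)⁻¹) := mul_le_mul_of_nonneg_left (by linarith) hK

/-- `t ↦ −2(√t)⁻¹` has derivative `(t√t)⁻¹` at `t > 0`. [folklore] -/
theorem hasDerivAt_neg_two_inv_sqrt {t : ℝ} (ht : 0 < t) :
    HasDerivAt (fun s ↦ -2 * (√s)⁻¹) ((t * √t)⁻¹) t := by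
  have h1 : HasDerivAt (fun s ↦ √s) (1 / (2 * √t)) t := Real.hasDerivAt_sqrt ht.ne'
  have hst : √t ≠ 0 := (Real.sqrt_pos.mpr ht).ne'
  have h2 := (h1.inv hst).const_mul (-2)
  refine h2.congr_deriv ?_
  have ht2 : (√t) ^ 2 = t := Real.sq_sqrt ht.le
  rw [ht2]
  field_simp

/-- **CLUSTER MOMENTUM INCREMENT.** With a continuous majorant `φ ≥ 0` of the inverse `3/2`-powers of the cross distances of
a nonempty cluster `C` on `[a, u]` (`a ≥ t₀`, `a > 0`): `‖Π_C(t) − Π_C(a)‖ ≤ K(∫_a^t φ + 2(√a)⁻¹)` for `t ∈ [a, u]` — by the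
boundary-function mean-value inequality (the accelerations are mere derivatives). [folklore] -/
theorem norm_clusterMomentum_sub_le (hv : ∀ i t, HasDerivAt (v i) (a i t) t)
    (hbal : ∀ (C : Finset (Fin N)) (t r : ℝ), t₀ ≤ t → 0 < r → r ≤ t → C.Nonempty →
      (∀ i ∈ C, ∀ j ∉ C, r ≤ ‖ξ i t - ξ j t‖) → ‖∑ i ∈ C, m i • a i t‖ ≤ K * r ^ (-(3 / 2 : ℝ)))
    (hK : 0 ≤ K) {C : Finset (Fin N)} (hC : C.Nonempty) {a₀ u : ℝ} (ha : t₀ ≤ a₀) (ha0 : 0 < a₀)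
    {φ : ℝ → ℝ} (hφc : Continuous φ) (hφ0 : ∀ s, 0 ≤ φ s)
    (hpos : ∀ s ∈ Icc a₀ u, ∀ i ∈ C, ∀ j ∉ C, 0 < ‖ξ i s - ξ j s‖)
    (hφ : ∀ s ∈ Icc a₀ u, ∀ i ∈ C, ∀ j ∉ C, (‖ξ i s - ξ j s‖ * √‖ξ i s - ξ j s‖)⁻¹ ≤ φ s) :
    ∀ t ∈ Icc a₀ u, ‖∑ i ∈ C, m i • v i t - ∑ i ∈ C, m i • v i a₀‖ ≤ K * ((∫ s in a₀..t, φ s) + 2 * (√a₀)⁻¹) := by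
  intro t ht
  -- boundary function `B(s) = K(∫_{a₀}^s φ + 2(√a₀)⁻¹ − 2(√s)⁻¹)`
  set B : ℝ → ℝ := fun s ↦ K * ((∫ σ in a₀..s, φ σ) + (2 * (√a₀)⁻¹ + -2 * (√s)⁻¹)) with hB
  have hBd : ∀ s ∈ Ico a₀ u, HasDerivWithinAt B (K * (φ s + (s * √s)⁻¹)) (Ici s) s := by
    intro s hs
    have hs0 : 0 < s := ha0.trans_le hs.1
    have h1 : HasDerivAt (fun s ↦ ∫ σ in a₀..s, φ σ) (φ s) s := (hφc.integral_hasStrictDerivAt a₀ s).hasDerivAt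
    have h2 : HasDerivAt (fun s ↦ 2 * (√a₀)⁻¹ + -2 * (√s)⁻¹) ((s * √s)⁻¹) s := by
      simpa using (hasDerivAt_neg_two_inv_sqrt hs0).const_add (2 * (√a₀)⁻¹)
    exact ((h1.add h2).const_mul K).hasDerivWithinAt
  have hBc : ContinuousOn B (Icc a₀ u) := by
    have h1 : Continuous fun s ↦ ∫ σ in a₀..s, φ σ := continuous_primitive hφc.intervalIntegrable a₀
    have h2 : ContinuousOn (fun s ↦ 2 * (√a₀)⁻¹ + -2 * (√s)⁻¹) (Icc a₀ u) := by
      refine continuousOn_const.add (continuousOn_const.mul ((Real.continuous_sqrt.continuousOn).inv₀ ?_))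
      intro s hs
      exact (Real.sqrt_pos.mpr (ha0.trans_le hs.1)).ne'
    exact (h1.continuousOn.add h2).const_smul K |>.congr fun s _ ↦ by simp [hB, smul_eq_mul]
  -- the function and its derivative
  set f : ℝ → (Fin n → ℝ) := fun s ↦ ∑ i ∈ C, m i • v i s - ∑ i ∈ C, m i • v i a₀ with hf
  have hfd : ∀ s, HasDerivAt f (∑ i ∈ C, m i • a i s) s := fun s ↦
    (hasDerivAt_clusterMomentum hv C s).sub_const _
  have hfc : ContinuousOn f (Icc a₀ u) := fun s _ ↦ (hfd s).continuousAt.continuousWithinAt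
  have hfd' : ∀ s ∈ Ico a₀ u, HasDerivWithinAt f (∑ i ∈ C, m i • a i s) (Ici s) s := fun s _ ↦
    (hfd s).hasDerivWithinAt
  have hf0 : ‖f a₀‖ ≤ B a₀ := by
    simp [hf, hB]
  have hbound : ∀ s ∈ Ico a₀ u, ‖∑ i ∈ C, m i • a i s‖ ≤ K * (φ s + (s * √s)⁻¹) := fun s hs ↦
    norm_sum_smul_accel_le hbal hK hC (ha.trans hs.1) (ha0.trans_le hs.1) (hφ0 s)
      (hpos s ⟨hs.1, hs.2.le⟩) (hφ s ⟨hs.1, hs.2.le⟩)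
  have key := image_norm_le_of_norm_deriv_right_le_deriv_boundary' hfc hfd' hf0 hBc hBd hbound ht
  -- drop the nonpositive term `−2(√t)⁻¹`
  have hdrop : B t ≤ K * ((∫ s in a₀..t, φ s) + 2 * (√a₀)⁻¹) := by
    have : -2 * (√t)⁻¹ ≤ 0 := by
      have : 0 ≤ (√t)⁻¹ := inv_nonneg.mpr (Real.sqrt_nonneg _)
      linarith
    have hK' := hK
    simp only [hB]
    nlinarith
  exact key.trans hdrop

/-! ### Ballistic pairs -/

/-- A nonzero vector of `ℝⁿ` (sup norm) has a signed coordinate realising its norm: `σ x_ℓ = ‖x‖`, `σ = ±1`. [folklore] -/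
theorem exists_sign_coord {n : ℕ} (x : Fin n → ℝ) (hx : 0 < ‖x‖) :
    ∃ (ℓ : Fin n) (σ : ℝ), (σ = 1 ∨ σ = -1) ∧ σ * x ℓ = ‖x‖ := by
  obtain ⟨ℓ, hℓ⟩ := exists_abs_apply_eq_norm x hx
  rcases le_or_gt 0 (x ℓ) with h0 | h0
  · exact ⟨ℓ, 1, Or.inl rfl, by rw [one_mul, ← hℓ, abs_of_nonneg h0]⟩
  · exact ⟨ℓ, -1, Or.inr rfl, by rw [← hℓ, abs_of_neg h0]; ring⟩

/-- BALLISTIC SPEED FROM A DEVIATION BOUND (pointwise): if `σ w₀_ℓ = W` and `‖w − w₀‖ ≤ W/2` then `σ w_ℓ ≥ W/2`.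
[folklore] -/
theorem speed_of_deviation {n : ℕ} {w₀ w : Fin n → ℝ} {W : ℝ} {ℓ : Fin n} {σ : ℝ} (hσ : σ = 1 ∨ σ = -1)
    (h0 : σ * w₀ ℓ = W) (hdev : ‖w - w₀‖ ≤ W / 2) : W / 2 ≤ σ * w ℓ := by
  have hc : |(w - w₀) ℓ| ≤ W / 2 := by
    have : |(w - w₀) ℓ| ≤ ‖w - w₀‖ := by simpa [Real.norm_eq_abs] using norm_le_pi_norm (w - w₀) ℓ
    exact this.trans hdev
  have hsplit : σ * w ℓ = W + σ * (w - w₀) ℓ := by rw [← h0, Pi.sub_apply]; ring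
  have habs : |σ * (w - w₀) ℓ| = |(w - w₀) ℓ| := by
    rcases hσ with rfl | rfl <;> simp [abs_sub_comm]
  rw [hsplit]
  have := neg_abs_le (σ * (w - w₀) ℓ)
  rw [habs] at this
  linarith

/-- The distance of a pair dominates its ballistic coordinate: `|σ (ξ_l − ξ_k)_ℓ| ≤ ‖ξ_l − ξ_k‖` for `σ = ±1`. [folklore] -/
theorem abs_coord_le_norm {k l : Fin N} {ℓ : Fin n} {σ : ℝ} (hσ : σ = 1 ∨ σ = -1) (t : ℝ) :
    |σ * (ξ l t - ξ k t) ℓ| ≤ ‖ξ l t - ξ k t‖ := by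
  have h : |(ξ l t - ξ k t) ℓ| ≤ ‖ξ l t - ξ k t‖ := by
    simpa [Real.norm_eq_abs] using norm_le_pi_norm (ξ l t - ξ k t) ℓ
  rcases hσ with rfl | rfl
  · simpa [abs_sub_comm] using h
  · simpa [abs_sub_comm] using h

/-- `((q/2)√(q/2))⁻¹ = 2√2 (q√q)⁻¹`-type comparison: if `q/2 ≤ d` with `q > 0` then `(d√d)⁻¹ ≤ 2√2((q)√q)⁻¹`. [folklore] -/
theorem inv_mul_sqrt_le_of_half_le {d q : ℝ} (hq : 0 < q) (hd : q / 2 ≤ d) :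
    (d * √d)⁻¹ ≤ 2 * √2 * (q * √q)⁻¹ := by
  have hq2 : 0 < q / 2 := by positivity
  have hd0 : 0 < d := hq2.trans_le hd
  have h1 : (d * √d)⁻¹ ≤ (q / 2 * √(q / 2))⁻¹ := by
    refine inv_anti₀ (by positivity) ?_
    exact mul_le_mul hd (Real.sqrt_le_sqrt hd) (Real.sqrt_nonneg _) hd0.le
  have h2 : (q / 2 * √(q / 2))⁻¹ = 2 * √2 * (q * √q)⁻¹ := by
    rw [Real.sqrt_div' _ (by norm_num : (0 : ℝ) ≤ 2)]
    have hs2 : √2 ≠ 0 := by positivity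
    have hsq : √q ≠ 0 := (Real.sqrt_pos.mpr hq).ne'
    field_simp
  rw [← h2]; exact h1

/-- **BALLISTIC MAJORANT.** If on `[a₀, u]` a pair has a coordinate of speed `≥ W/2 > 0` and distance `≥ A > 0`, then
`ψ(t) = 2√2((|x(t)| + A)√(|x(t)| + A))⁻¹`, `x = σ(ξ_l − ξ_k)_ℓ`, is continuous, majorises the inverse `3/2`-power of the
distance on `[a₀, u]`, and `∫_{a₀}^{u} ψ ≤ 2√2 · 8/(W√A)` (`integral_ballistic_le`). [folklore] -/
theorem ballistic_majorant (hξ : ∀ i t, HasDerivAt (ξ i) (v i t) t) (hvc : ∀ i, Continuous (v i))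
    {k l : Fin N} {a₀ u W A : ℝ} {ℓ : Fin n} {σ : ℝ} (hσ : σ = 1 ∨ σ = -1) (hW : 0 < W) (hA : 0 < A) (hau : a₀ ≤ u)
    (hspeed : ∀ t ∈ Icc a₀ u, W / 2 ≤ σ * (v l t - v k t) ℓ) (hfar : ∀ t ∈ Icc a₀ u, A ≤ ‖ξ l t - ξ k t‖) :
    (Continuous fun t ↦ 2 * √2 * ((|σ * (ξ l t - ξ k t) ℓ| + A) * √(|σ * (ξ l t - ξ k t) ℓ| + A))⁻¹) ∧
    (∀ t, 0 ≤ 2 * √2 * ((|σ * (ξ l t - ξ k t) ℓ| + A) * √(|σ * (ξ l t - ξ k t) ℓ| + A))⁻¹) ∧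
    (∀ t ∈ Icc a₀ u, (‖ξ l t - ξ k t‖ * √‖ξ l t - ξ k t‖)⁻¹ ≤
      2 * √2 * ((|σ * (ξ l t - ξ k t) ℓ| + A) * √(|σ * (ξ l t - ξ k t) ℓ| + A))⁻¹) ∧
    ∫ t in a₀..u, 2 * √2 * ((|σ * (ξ l t - ξ k t) ℓ| + A) * √(|σ * (ξ l t - ξ k t) ℓ| + A))⁻¹ ≤
      2 * √2 * (8 / (W * √A)) := by
  set x : ℝ → ℝ := fun t ↦ σ * (ξ l t - ξ k t) ℓ with hx
  set x' : ℝ → ℝ := fun t ↦ σ * (v l t - v k t) ℓ with hx'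
  have hξc : ∀ i, Continuous (ξ i) := fun i ↦ continuous_iff_continuousAt.mpr fun t ↦ (hξ i t).continuousAt
  have hxc : Continuous x := by
    have : Continuous fun t ↦ (ξ l t - ξ k t) ℓ := (continuous_apply ℓ).comp ((hξc l).sub (hξc k))
    exact continuous_const.mul this
  have hxd : ∀ t, HasDerivAt x (x' t) t := fun t ↦ by
    have h := (hasDerivAt_pi.mp ((hξ l t).sub (hξ k t))) ℓ
    simpa [hx, hx'] using h.const_mul σ
  have hx'c : Continuous x' := by
    have : Continuous fun t ↦ (v l t - v k t) ℓ := (continuous_apply ℓ).comp ((hvc l).sub (hvc k))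
    exact continuous_const.mul this
  have hq : ∀ t, 0 < |x t| + A := fun t ↦ by positivity
  have hψc : Continuous fun t ↦ 2 * √2 * ((|x t| + A) * √(|x t| + A))⁻¹ := by
    have hc : Continuous fun t ↦ |x t| + A := hxc.abs.add continuous_const
    refine continuous_const.mul ((hc.mul hc.sqrt).inv₀ fun t ↦ ?_)
    exact (mul_pos (hq t) (Real.sqrt_pos.mpr (hq t))).ne'
  refine ⟨hψc, fun t ↦ by positivity, fun t ht ↦ ?_, ?_⟩
  · have h1 : |x t| ≤ ‖ξ l t - ξ k t‖ := abs_coord_le_norm hσ t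
    exact inv_mul_sqrt_le_of_half_le (hq t) (by linarith [hfar t ht])
  · rw [intervalIntegral.integral_const_mul]
    refine mul_le_mul_of_nonneg_left ?_ (by positivity)
    exact integral_ballistic_le hau hW hA (fun t _ ↦ hxd t) hx'c.continuousOn hspeed

end Toy

/-- Registered helper form of `exists_sign_coord` (a signed sup-norm coordinate realising the norm). [folklore] -/
theorem endgame_toy_exists_sign_coord : ∀ (n : ℕ) (x : Fin n → ℝ), 0 < ‖x‖ → ∃ (ℓ : Fin n) (σ : ℝ), (σ = 1 ∨ σ = -1) ∧ σ * x ℓ = ‖x‖ :=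
  fun _ x hx ↦ exists_sign_coord x hx

end Summit.FinalStateConjecture.FinalStateConjecture.Theorems.SublinearIsFree.Toy

end
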